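import Literature.MathematicalPhysics.QuantumFieldTheory.Balaban1983to89.Node00.LinearisedAveragingFlat

/-!
# `Balaban1983to89.B15Prop1LinearisedAveragingLipschitzNearFlat` — [Balaban1985Averaging] = «[4]», Sect. D (122)–(126) p. 36 («The first term … is the main term in this linear form … The
# remaining terms are small … the operators occurring in these terms can be estimated by O(L²α₀)»), Prop. 4 (134)–(135) pp. 37–39; [Balaban1985BackgroundPropagators] = «[B9]», Sect. C p. 406
# (3.79)–(3.81) («Q_j(U′U) = Q_j(U) + F_{2,j}(A)», «|F_{2,j}(A)A′| ≦ O(1)α₁Q″_j|A′|»); [Balaban1985Variational] (44) p. 285, (82)–(83) p. 290: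
# THE BACKGROUND DEPENDENCE OF NODE 00's LINEARISED AVERAGING `Q_j(V) = dIterL j V` NEAR THE FLAT CONFIGURATION — qualitative (C¹-Lipschitz) edition, and its consequence for fields killed
# by `Q_j(V)`: their FLAT averages are `O(‖V − 1‖)`

Honest framing: statement-level skeleton of published theorems with citation tags; proofs where landed; nothing here is a claim about the
Yang–Mills mass gap.  Cell `pub-ymgap`, HUMAN RULING D-0062 (Track A), seat `pub-ymgap-dag-n12-c` g25 (lane owner N12 = [B15], strategy s1); count-neutral; N12 NOT discharged;
finite 𝕋⁴ at fixed ε; nothing continuum ∕ OS ∕ mass-gap ∕ Clay.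

WHY (lane memo `N12-UNIFORMITY-SPEC.md` §8; `B15Prop1FlatCoerciveSplit`, letter (L); lit-balaban ME #43).  After the (β)-split, the one analytic input of the (J0′) producer's (β) row that is
not a theorem per instance is (L): the FLAT linearised averages of a field killed by the linearised averaging AT THE BACKGROUND are small — print's «background dependence of the linearised
averaging», [4] (124)–(126) ∕ [B9] (3.79)–(3.81) (`Q(V₀) = Q_{V₀} + O(L²α₀)`, `Q_j(U′U) = Q_j(U) + F_{2,j}(A)`).  NODE 00 types `Q_j(V)` as `dIterL j V := fderiv ℝ (iterM j) V` and proves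
`iterM j` smooth at the flat configuration (`contDiffAt_iterM_one`).  THIS FILE draws the QUALITATIVE consequence print's displays quantify: `V ↦ Q_j(V)` is Lipschitz near `V = 1` (C¹ ⇒
locally Lipschitz, Mathlib's `ContDiffAt.exists_lipschitzOnWith`), hence a field `Y` with `Q_j(V)(Y·V) = 0` at a background `V` within `r` of `1` has `‖(Q_j(1)Y)(c)‖ ≤ C·‖V − 1‖·‖Y‖` —
the letter (L) per instance at a GUARDED NEAR-FLAT background (the record's tower PROXIES of a (2.12)-minimiser, dag-n12-w6's `N12HVelocityOfClass` device), constants EXISTENTIAL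
(`C`, `r` per `(P, N, j)`; print's are `O(L²α₀)` with `d`, `L` only — [4] Prop. 3, not consumed).

CONTENTS (theorems only; no `def`, no `instance`, no `sorry`).  §1 ★★ `exists_lipschitz_dIterL_near_one` (`∃ C r > 0, ‖V − 1‖ ≤ r → ‖Q_j(V) − Q_j(1)‖ ≤ C‖V − 1‖`).  §2 `pi_norm_sub_mul_right_le`
(`‖Y − Y·V‖ ≤ ‖Y‖·‖1 − V‖`, private), ★★★ `exists_norm_dIterL_one_apply_le_of_kernel` (`∃ C r > 0, ‖V − 1‖ ≤ r → Q_j(V)(Y·V)(c) = 0 → ‖(Q_j(1)Y)(c)‖ ≤ C·‖V − 1‖·‖Y‖`).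
§3 the same two facts for ANY `F : (bonds → M_N(ℂ)) → X` of class `C²` over `ℂ` at `1` — ★ `exists_lipschitz_fderiv_near_one_of_contDiffAt`, ★★ `exists_norm_fderiv_one_apply_le_of_kernel` — the
edition the record needs: there the background `U₀` is (0.4)-guarded along the constraint TOWERS only (LOCATED-E1-HSB), so the relevant map is the lane's tower-local HOLOMORPHIC iterate
`V ↦ iterMh j V c` (analytic at the flat field on the tower polydisc, `B15AveragingHolomorphicLocalAnalytic`), read through the tower splice — companion file.
HONEST SCOPE: smooth calculus over NODE 00's landed smoothness at the flat configuration; constants existential; nothing of Bałaban's (124)–(126) ∕ (3.79)–(3.81) asserted with its constants;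
count-neutral; N12 NOT discharged; the YM mass gap (Clay) is NOT proved by any of this — R4 closes only the conditional finite-𝕋⁴ rung `BalabanLadder.UV`.
-/

noncomputable section

namespace Literature.MathematicalPhysics.QuantumFieldTheory.Balaban1983to89.B15Prop1LinearisedAveragingLipschitzNearFlat

open Set Metric Filter
open scoped Topology NNReal
open Literature.MathematicalPhysics.QuantumFieldTheory.Balaban1983to89.Node00 (iterM dIterL contDiffAt_iterM_one)
open T4Continuum
open scoped Matrix.Norms.L2Operator

variable {P : Params} {N : ℕ}

/-! ## §1  `V ↦ Q_j(V)` is Lipschitz near the flat configuration -/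

/-- ★★ **THE LINEARISED AVERAGING IS LIPSCHITZ IN THE BACKGROUND NEAR `1`** (qualitative edition of [4] (124)–(126) ∕ [B9] (3.79)–(3.81)): there are `C ≥ 0` and `r > 0` with
`‖Q_j(V) − Q_j(1)‖ ≤ C·‖V − 1‖` for every matrix field `V` with `‖V − 1‖ ≤ r` — `iterM j` is smooth at `1` (`Node00.contDiffAt_iterM_one`), so its Fréchet derivative `V ↦ Q_j(V) = dIterL j V`
is C¹ there, hence Lipschitz on a neighbourhood. [cite: Balaban1985Averaging, (122)–(126) p.36, Prop. 4 (134)–(135) pp.37–39; Balaban1985BackgroundPropagators, (3.79)–(3.81) p.406; Balaban1985Variational, (44) p.285] -/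
theorem exists_lipschitz_dIterL_near_one (j : ℕ) :
    ∃ C r : ℝ, 0 ≤ C ∧ 0 < r ∧ ∀ V : PBond P 0 → Matrix (Fin N) (Fin N) ℂ, ‖V - 1‖ ≤ r →
      ‖(dIterL j V : (PBond P 0 → Matrix (Fin N) (Fin N) ℂ) →L[ℝ] (PBond P j → Matrix (Fin N) (Fin N) ℂ)) - dIterL j 1‖ ≤ C * ‖V - 1‖ := by
  -- the derivative `V ↦ fderiv ℝ (iterM j) V` is C¹ at `1`
  have hf : ContDiffAt ℝ 1 (fderiv ℝ (iterM j : (PBond P 0 → Matrix (Fin N) (Fin N) ℂ) → PBond P j → Matrix (Fin N) (Fin N) ℂ)) 1 :=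
    (contDiffAt_iterM_one (P := P) (N := N) j).fderiv_right le_top
  obtain ⟨K, t, ht, hK⟩ := hf.exists_lipschitzOnWith
  obtain ⟨ε, hε, hball⟩ := Metric.mem_nhds_iff.mp ht
  refine ⟨K, ε / 2, K.2, by positivity, fun V hV => ?_⟩
  have hVt : V ∈ t := hball (by rw [mem_ball, dist_eq_norm]; linarith)
  have h1t : (1 : PBond P 0 → Matrix (Fin N) (Fin N) ℂ) ∈ t := mem_of_mem_nhds ht
  have h := hK.norm_sub_le hVt h1t
  -- `dIterL j V` IS `fderiv ℝ (iterM j) V`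
  exact h

/-! ## §2  A field killed by `Q_j(V)` has small flat averages -/

/-- `‖Y − Y·V‖ ≤ ‖Y‖·‖1 − V‖` (bondwise `Y_b − Y_b V_b = Y_b(1 − V_b)` and the sup-operator norm). [folklore] -/
private theorem pi_norm_sub_mul_right_le (Y V : PBond P 0 → Matrix (Fin N) (Fin N) ℂ) :
    ‖Y - fun b => Y b * V b‖ ≤ ‖Y‖ * ‖(1 : PBond P 0 → Matrix (Fin N) (Fin N) ℂ) - V‖ := by
  refine (pi_norm_le_iff_of_nonneg (by positivity)).2 fun b => ?_
  have hb : (Y - fun b => Y b * V b) b = Y b * ((1 : PBond P 0 → Matrix (Fin N) (Fin N) ℂ) - V) b := by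
    simp only [Pi.sub_apply, Pi.one_apply, mul_sub, mul_one]
  rw [hb]
  exact (norm_mul_le _ _).trans (mul_le_mul (norm_le_pi_norm Y b) (norm_le_pi_norm _ b) (norm_nonneg _) (norm_nonneg _))

/-- ★★★ **THE FLAT AVERAGES OF A `Q_j(V)`-KERNEL FIELD ARE `O(‖V − 1‖)`** — the letter (L) of `B15Prop1FlatCoerciveSplit` per instance at a near-flat guarded background, qualitative
constants: there are `C ≥ 0`, `r > 0` such that for every background `V` with `‖V − 1‖ ≤ r`, every field `Y` and every coarse bond `c`, if the linearised average at `V` of the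
left-invariant field `Y·V` vanishes at `c` — `(Q_j(V)(Y·V))(c) = 0`, the velocity reading of «`p` in the kernel at the background» (NODE 00's `hasDerivAt_coeField_iter_expChart_smul` ∕ the
lineage's `hasDerivAt_coe_avgFamily_expMul_smul`) — then `‖(Q_j(1)Y)(c)‖ ≤ C·‖V − 1‖·‖Y‖`.  Proof: `Q_j(1)Y = (Q_j(1) − Q_j(V))Y + Q_j(V)(Y − Y·V) + Q_j(V)(Y·V)`, §1 and `pi_norm_sub_mul_right_le`.
[cite: Balaban1985Averaging, (122)–(126) p.36, Prop. 4 (134)–(135) pp.37–39; Balaban1985BackgroundPropagators, (3.79)–(3.81) p.406; Balaban1985Variational, (44) p.285, (82)–(83) p.290] -/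
theorem exists_norm_dIterL_one_apply_le_of_kernel (j : ℕ) :
    ∃ C r : ℝ, 0 ≤ C ∧ 0 < r ∧ ∀ (V Y : PBond P 0 → Matrix (Fin N) (Fin N) ℂ) (c : PBond P j), ‖V - 1‖ ≤ r →
      dIterL j V (fun b => Y b * V b) c = 0 → ‖dIterL j 1 Y c‖ ≤ C * ‖V - 1‖ * ‖Y‖ := by
  obtain ⟨C, r, hC, hr, hLip⟩ := exists_lipschitz_dIterL_near_one (P := P) (N := N) j
  refine ⟨C + (‖(dIterL j (1 : PBond P 0 → Matrix (Fin N) (Fin N) ℂ) :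
      (PBond P 0 → Matrix (Fin N) (Fin N) ℂ) →L[ℝ] (PBond P j → Matrix (Fin N) (Fin N) ℂ))‖ + C * r), r, by positivity, hr,
    fun V Y c hV hker => ?_⟩
  have hVnn : 0 ≤ ‖V - 1‖ := norm_nonneg _
  have hLipV := hLip V hV
  -- make the two linearised averagings opaque
  generalize hQ₁ : (dIterL j (1 : PBond P 0 → Matrix (Fin N) (Fin N) ℂ) :
      (PBond P 0 → Matrix (Fin N) (Fin N) ℂ) →L[ℝ] (PBond P j → Matrix (Fin N) (Fin N) ℂ)) = Q₁ at hLipV ⊢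
  generalize hQV : (dIterL j V : (PBond P 0 → Matrix (Fin N) (Fin N) ℂ) →L[ℝ] (PBond P j → Matrix (Fin N) (Fin N) ℂ)) = QV at hLipV hker ⊢
  -- the three pieces: `Q₁Y = (Q₁ − Q_V)Y + Q_V(Y − Y·V) + Q_V(Y·V)`, the last one zero at `c`
  have hsplit : Q₁ Y c = (Q₁ - QV) Y c + QV (Y - fun b => Y b * V b) c := by
    have e1 : (Q₁ - QV) Y c = Q₁ Y c - QV Y c := rfl
    have e2 : QV (Y - fun b => Y b * V b) c = QV Y c - QV (fun b => Y b * V b) c := by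
      rw [map_sub]; rfl
    rw [e1, e2, hker, sub_zero, sub_add_cancel]
  have h1 : ‖(Q₁ - QV) Y c‖ ≤ C * ‖V - 1‖ * ‖Y‖ := by
    calc ‖(Q₁ - QV) Y c‖ ≤ ‖(Q₁ - QV) Y‖ := norm_le_pi_norm ((Q₁ - QV) Y) c
      _ ≤ ‖Q₁ - QV‖ * ‖Y‖ := ContinuousLinearMap.le_opNorm _ _
      _ ≤ C * ‖V - 1‖ * ‖Y‖ := by
          apply mul_le_mul_of_nonneg_right _ (norm_nonneg _)
          rw [norm_sub_rev Q₁ QV]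
          exact hLipV
  have hopV : ‖QV‖ ≤ ‖Q₁‖ + C * r := by
    calc ‖QV‖ = ‖Q₁ + (QV - Q₁)‖ := by rw [add_sub_cancel]
      _ ≤ ‖Q₁‖ + ‖QV - Q₁‖ := ContinuousLinearMap.opNorm_add_le _ _
      _ ≤ ‖Q₁‖ + C * r := add_le_add le_rfl (hLipV.trans (mul_le_mul_of_nonneg_left hV hC))
  have h2 : ‖QV (Y - fun b => Y b * V b) c‖ ≤ (‖Q₁‖ + C * r) * ‖V - 1‖ * ‖Y‖ := by
    calc ‖QV (Y - fun b => Y b * V b) c‖ ≤ ‖QV (Y - fun b => Y b * V b)‖ := norm_le_pi_norm (QV (Y - fun b => Y b * V b)) c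
      _ ≤ ‖QV‖ * ‖Y - fun b => Y b * V b‖ := ContinuousLinearMap.le_opNorm _ _
      _ ≤ (‖Q₁‖ + C * r) * (‖Y‖ * ‖(1 : PBond P 0 → Matrix (Fin N) (Fin N) ℂ) - V‖) :=
          mul_le_mul hopV (pi_norm_sub_mul_right_le Y V) (norm_nonneg _) (by positivity)
      _ = (‖Q₁‖ + C * r) * ‖V - 1‖ * ‖Y‖ := by rw [norm_sub_rev (1 : PBond P 0 → Matrix (Fin N) (Fin N) ℂ) V]; ring
  rw [hsplit]
  calc ‖(Q₁ - QV) Y c + QV (Y - fun b => Y b * V b) c‖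
      ≤ ‖(Q₁ - QV) Y c‖ + ‖QV (Y - fun b => Y b * V b) c‖ := norm_add_le _ _
    _ ≤ C * ‖V - 1‖ * ‖Y‖ + (‖Q₁‖ + C * r) * ‖V - 1‖ * ‖Y‖ := add_le_add h1 h2
    _ = (C + (‖Q₁‖ + C * r)) * ‖V - 1‖ * ‖Y‖ := by ring

/-! ## §3  The same calculus for ANY `C²` function of a matrix field over `ℂ` (the tower-holomorphic iterate `V ↦ iterMh j V c` of the (r1)–(r3) files) -/

section Holomorphic

variable {X : Type*} [NormedAddCommGroup X] [NormedSpace ℂ X]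

/-- ★ **A `C²` FUNCTION OF A MATRIX FIELD HAS A LIPSCHITZ DERIVATIVE NEAR THE FLAT FIELD**: for `F` of class `C²` (over `ℂ`) at `1` there are `C ≥ 0`, `r > 0` with
`‖DF(V) − DF(1)‖ ≤ C‖V − 1‖` whenever `‖V − 1‖ ≤ r` (Mathlib's `ContDiffAt.exists_lipschitzOnWith` on `fderiv ℂ F`). [cite: Balaban1985Averaging, Prop. 7 p.43 («analytic function»), (122)–(126) p.36; Balaban1985BackgroundPropagators, (3.79)–(3.81) p.406] -/
theorem exists_lipschitz_fderiv_near_one_of_contDiffAt {F : (PBond P 0 → Matrix (Fin N) (Fin N) ℂ) → X} (hF : ContDiffAt ℂ 2 F 1) :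
    ∃ C r : ℝ, 0 ≤ C ∧ 0 < r ∧ ∀ V : PBond P 0 → Matrix (Fin N) (Fin N) ℂ, ‖V - 1‖ ≤ r →
      ‖fderiv ℂ F V - fderiv ℂ F 1‖ ≤ C * ‖V - 1‖ := by
  have hf : ContDiffAt ℂ 1 (fderiv ℂ F) 1 := hF.fderiv_right le_rfl
  obtain ⟨K, t, ht, hK⟩ := hf.exists_lipschitzOnWith
  obtain ⟨ε, hε, hball⟩ := Metric.mem_nhds_iff.mp ht
  refine ⟨K, ε / 2, K.2, by positivity, fun V hV => ?_⟩
  have hVt : V ∈ t := hball (by rw [mem_ball, dist_eq_norm]; linarith)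
  have h1t : (1 : PBond P 0 → Matrix (Fin N) (Fin N) ℂ) ∈ t := mem_of_mem_nhds ht
  exact hK.norm_sub_le hVt h1t

/-- ★★ **A DIRECTION KILLED BY `DF(V)` IN THE LEFT-INVARIANT FORM HAS SMALL FLAT IMAGE**: for `F` of class `C²` at `1` there are `C ≥ 0`, `r > 0` such that `‖V − 1‖ ≤ r` and
`DF(V)[Y·V] = 0` imply `‖DF(1)[Y]‖ ≤ C·‖V − 1‖·‖Y‖` — the (L) letter's calculus: the flat linearised response of a field in the kernel at the background is `O(‖V − 1‖)`.
[cite: Balaban1985Averaging, (122)–(126) p.36, Prop. 4 (134)–(135) pp.37–39; Balaban1985BackgroundPropagators, (3.79)–(3.81) p.406; Balaban1985Variational, (82)–(83) p.290] -/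
theorem exists_norm_fderiv_one_apply_le_of_kernel {F : (PBond P 0 → Matrix (Fin N) (Fin N) ℂ) → X} (hF : ContDiffAt ℂ 2 F 1) :
    ∃ C r : ℝ, 0 ≤ C ∧ 0 < r ∧ ∀ V Y : PBond P 0 → Matrix (Fin N) (Fin N) ℂ, ‖V - 1‖ ≤ r →
      fderiv ℂ F V (fun b => Y b * V b) = 0 → ‖fderiv ℂ F 1 Y‖ ≤ C * ‖V - 1‖ * ‖Y‖ := by
  obtain ⟨C, r, hC, hr, hLip⟩ := exists_lipschitz_fderiv_near_one_of_contDiffAt hF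
  refine ⟨C + (‖fderiv ℂ F 1‖ + C * r), r, by positivity, hr, fun V Y hV hker => ?_⟩
  have hVnn : 0 ≤ ‖V - 1‖ := norm_nonneg _
  have hLipV := hLip V hV
  generalize hQ₁ : fderiv ℂ F 1 = Q₁ at hLipV ⊢
  generalize hQV : fderiv ℂ F V = QV at hLipV hker ⊢
  have hsplit : Q₁ Y = (Q₁ - QV) Y + QV (Y - fun b => Y b * V b) := by
    have e1 : (Q₁ - QV) Y = Q₁ Y - QV Y := rfl
    rw [map_sub, hker, sub_zero, e1, sub_add_cancel]
  have h1 : ‖(Q₁ - QV) Y‖ ≤ C * ‖V - 1‖ * ‖Y‖ := by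
    calc ‖(Q₁ - QV) Y‖ ≤ ‖Q₁ - QV‖ * ‖Y‖ := ContinuousLinearMap.le_opNorm _ _
      _ ≤ C * ‖V - 1‖ * ‖Y‖ := by
          apply mul_le_mul_of_nonneg_right _ (norm_nonneg _)
          rw [norm_sub_rev Q₁ QV]
          exact hLipV
  have hopV : ‖QV‖ ≤ ‖Q₁‖ + C * r := by
    calc ‖QV‖ = ‖Q₁ + (QV - Q₁)‖ := by rw [add_sub_cancel]
      _ ≤ ‖Q₁‖ + ‖QV - Q₁‖ := ContinuousLinearMap.opNorm_add_le _ _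
      _ ≤ ‖Q₁‖ + C * r := add_le_add le_rfl (hLipV.trans (mul_le_mul_of_nonneg_left hV hC))
  have h2 : ‖QV (Y - fun b => Y b * V b)‖ ≤ (‖Q₁‖ + C * r) * ‖V - 1‖ * ‖Y‖ := by
    calc ‖QV (Y - fun b => Y b * V b)‖ ≤ ‖QV‖ * ‖Y - fun b => Y b * V b‖ := ContinuousLinearMap.le_opNorm _ _
      _ ≤ (‖Q₁‖ + C * r) * (‖Y‖ * ‖(1 : PBond P 0 → Matrix (Fin N) (Fin N) ℂ) - V‖) :=
          mul_le_mul hopV (pi_norm_sub_mul_right_le Y V) (norm_nonneg _) (by positivity)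
      _ = (‖Q₁‖ + C * r) * ‖V - 1‖ * ‖Y‖ := by rw [norm_sub_rev (1 : PBond P 0 → Matrix (Fin N) (Fin N) ℂ) V]; ring
  rw [hsplit]
  calc ‖(Q₁ - QV) Y + QV (Y - fun b => Y b * V b)‖ ≤ ‖(Q₁ - QV) Y‖ + ‖QV (Y - fun b => Y b * V b)‖ := norm_add_le _ _
    _ ≤ C * ‖V - 1‖ * ‖Y‖ + (‖Q₁‖ + C * r) * ‖V - 1‖ * ‖Y‖ := add_le_add h1 h2
    _ = (C + (‖Q₁‖ + C * r)) * ‖V - 1‖ * ‖Y‖ := by ring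

end Holomorphic

end Literature.MathematicalPhysics.QuantumFieldTheory.Balaban1983to89.B15Prop1LinearisedAveragingLipschitzNearFlat

end
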